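import Literature.LinearAlgebra.Matrix.PfaffianDeterminant
import HarnessLib

/-!
# The Pfaffian of an alternating matrix, VI: the Pfaffian characteristic polynomial `s ↦ Pf(B(D − s))`

Let `B` be an alternating matrix (`Bᵀ = -B`, zero diagonal) and `D` a matrix such that `B D` is
again alternating — equivalently, for invertible `B`, `B D B⁻¹ = Dᵀ` ("`C Q C⁻¹ = Qᵀ`",
Montvay 2002, eq. (45)).  Then `B (D − s)` is alternating for every scalar `s`, and

* `pfaffianCharpoly B D`, the polynomial `P(X) = Pf(B D − X B)` with `P(s) = Pf(B (D − s))`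
  (`eval_pfaffianCharpoly`) — "the Pfaffian of the auxiliary operator `C(D_𝒥 − s)` … is a
  polynomial in the matrix elements and in particular in `s`" (Lucini–Patella–Ramos–Tantalo 2016,
  App. D);
* `pfaffianCharpoly_sq` — **`P² = det B · χ_D`** over any commutative ring (Cayley's theorem
  `det_eq_pfaffian_sq` applied to `B D − X B = B · (D − X)` over `R[X]`): "`Det_K(D_𝒥 − s) =
  [Pf_K C(D_𝒥 − s)]²`" (ibid., with `det C = 1`);
* `coeff_pfaffianCharpoly_half`, `coeff_pfaffianCharpoly_eq_zero` — `P` has degree `≤ n/2` and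
  `X^{n/2}`-coefficient `(-1)^{n/2} Pf B`: "the overall normalization is determined by the value of
  the Pfaffian in the `s → ∞` limit" (ibid.);
* over a field, for `det B ≠ 0`: `rootMultiplicity_charpoly_eq_two_mul`,
  `even_rootMultiplicity_charpoly`, `roots_charpoly_eq_add` — **every eigenvalue of `D` has EVEN
  algebraic multiplicity `2 m_α`**, where `m_α` is its multiplicity as a root of `P`: "Notice that
  the algebraic multiplicity of `λ_α` is `2m_α`" (ibid.; Montvay 2002 after (45): "every eigenvalue
  of `Q` … is (at least) doubly degenerate"); `natDegree_pfaffianCharpoly` (`= n/2`, `n` even),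
  `leadingCoeff_pfaffianCharpoly`;
* over an algebraically closed field: `pfaffian_mul_eq_mul_prod_roots` —
  **`Pf(B D) = Pf(B) · ∏_α λ_α^{m_α}`**, the product over the roots of `P` with multiplicity, i.e.
  over the eigenvalues of `D` with HALF their algebraic multiplicities (Lucini et al., eq. for
  `Pf_K C D_𝒥` at `s = 0`, before the conjugate roots are paired; the printed formula takes the
  normalization `Pf(C) = 1`).

The `γ₅`-hermiticity half of Lucini et al.'s argument (reality of `P` on the real axis, pairing of
conjugate roots, the sign statement) is in
`Literature/MathematicalPhysics/QuantumFieldTheory/GammaHermiticityPfaffian.lean`; the lattice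
instance (C⋆ boundary conditions) in
`Literature/MathematicalPhysics/QuantumLattice/CPeriodicPfaffianSign.lean`.

## References

* B. Lucini, A. Patella, A. Ramos, N. Tantalo, *Charged hadrons in local finite-volume QED+QCD with
  C⋆ boundary conditions*, JHEP **02** (2016) 076, arXiv:1509.01636, App. D "Anatomy of the sign
  problem" [corpus:paper-arxiv-1509.01636 p0031]. [LuciniEtAl2016]
* I. Montvay, *Supersymmetric Yang–Mills theory on the lattice*, Int. J. Mod. Phys. A **17** (2002)
  2377, arXiv:hep-lat/0112007, §2.2 eqs. (40)–(47) (the same structure for the adjoint Majorana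
  fermion: `M = CQ` antisymmetric, `det Q = [Pf M]²`, doubly degenerate spectrum). [Montvay2002]
* A. Cayley (1849); R. Goodman, N. R. Wallach, GTM 255, Cor. B.2.9 — `det = Pf²`
  (`PfaffianDeterminant.lean`). [Cayley1849] [GoodmanWallachGTM255]
-/

noncomputable section

namespace Literature.LinearAlgebra.Matrix

open Finset Polynomial
open _root_.Matrix

variable {R : Type*} [CommRing R]

/-! ## The polynomial `Pf(B D − X B)` -/

/-- The **Pfaffian characteristic polynomial** of the pair `(B, D)`: `P(X) = Pf(B D − X·B) ∈ R[X]`,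
whose value at `s` is `Pf(B (D − s))` (`eval_pfaffianCharpoly`) — "the Pfaffian of the auxiliary
operator `C (D_𝒥 − s)` for a generic complex number `s`. This Pfaffian is a polynomial in the matrix
elements and in particular in `s`". [cite: LuciniEtAl2016, App. D (the polynomial Pf_K C(D_𝒥 − s))] -/
def pfaffianCharpoly {n : ℕ} (B D : Matrix (Fin n) (Fin n) R) : R[X] :=
  pfaffian ((B * D).map (Polynomial.C : R →+* R[X]) - (X : R[X]) • B.map (Polynomial.C : R →+* R[X]))

variable {n : ℕ} (B D : Matrix (Fin n) (Fin n) R)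

/-- `P(s) = Pf(B D − s B)`: evaluating the Pfaffian characteristic polynomial at `s` gives the
Pfaffian of `B (D − s)` (the Pfaffian commutes with the evaluation homomorphism, `pfaffian_map`).
[cite: LuciniEtAl2016, App. D (the polynomial Pf_K C(D_𝒥 − s))] -/
theorem eval_pfaffianCharpoly (s : R) : (pfaffianCharpoly B D).eval s = pfaffian (B * D - s • B) := by
  unfold pfaffianCharpoly
  rw [← Polynomial.coe_evalRingHom, ← pfaffian_map]
  congr 1
  ext i j
  simp only [Matrix.map_apply, Matrix.sub_apply, Matrix.smul_apply, smul_eq_mul,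
    Polynomial.coe_evalRingHom, eval_sub, eval_mul, eval_C, eval_X]

/-- The same with the factorisation `B D − s B = B (D − s·1)` displayed.
[cite: LuciniEtAl2016, App. D (the polynomial Pf_K C(D_𝒥 − s))] -/
theorem eval_pfaffianCharpoly' (s : R) :
    (pfaffianCharpoly B D).eval s = pfaffian (B * (D - s • (1 : Matrix (Fin n) (Fin n) R))) := by
  rw [eval_pfaffianCharpoly, Matrix.mul_sub, Matrix.mul_smul, Matrix.mul_one]

/-- At `s = 0`: `P(0) = Pf(B D)`. [cite: LuciniEtAl2016, App. D ("For s = 0 one gets …")] -/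
theorem eval_zero_pfaffianCharpoly : (pfaffianCharpoly B D).eval 0 = pfaffian (B * D) := by
  rw [eval_pfaffianCharpoly, zero_smul, sub_zero]

/-! ## `P² = det B · χ_D` (Cayley) -/

/-- The polynomial matrix `B D − X B` is alternating when `B` and `B D` are. [folklore] -/
private theorem transpose_polyMatrix (hB : Bᵀ = -B) (hM : (B * D)ᵀ = -(B * D)) :
    ((B * D).map (Polynomial.C : R →+* R[X]) - (X : R[X]) • B.map (Polynomial.C : R →+* R[X]))ᵀ =
      -((B * D).map (Polynomial.C : R →+* R[X]) - (X : R[X]) • B.map (Polynomial.C : R →+* R[X])) := by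
  ext i j
  have h1 : B j i = -B i j := by simpa using congrFun (congrFun hB i) j
  have h2 : (B * D) j i = -(B * D) i j := by simpa using congrFun (congrFun hM i) j
  simp only [transpose_apply, Matrix.sub_apply, Matrix.neg_apply, Matrix.map_apply, Matrix.smul_apply,
    h1, h2, map_neg, smul_eq_mul]
  ring

/-- The polynomial matrix `B D − X B` has zero diagonal when `B` and `B D` have. [folklore] -/
private theorem polyMatrix_apply_self (hBd : ∀ i, B i i = 0) (hMd : ∀ i, (B * D) i i = 0) (i : Fin n) :
    ((B * D).map (Polynomial.C : R →+* R[X]) - (X : R[X]) • B.map (Polynomial.C : R →+* R[X])) i i = 0 := by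
  simp only [Matrix.sub_apply, Matrix.map_apply, Matrix.smul_apply, hBd i, hMd i, map_zero, smul_zero,
    sub_zero]

/-- `B D − X B = B · (−charmatrix D)` over `R[X]`. [folklore] -/
private theorem polyMatrix_eq_mul_neg_charmatrix :
    (B * D).map (Polynomial.C : R →+* R[X]) - (X : R[X]) • B.map (Polynomial.C : R →+* R[X]) =
      B.map (Polynomial.C : R →+* R[X]) * (-(charmatrix D)) := by
  have hc : -(charmatrix D) = D.map (Polynomial.C : R →+* R[X]) -
      (X : R[X]) • (1 : Matrix (Fin n) (Fin n) R[X]) := by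
    rw [charmatrix, neg_sub, RingHom.mapMatrix_apply, Matrix.scalar_apply, ← smul_one_eq_diagonal]
  rw [hc, Matrix.mul_sub, Matrix.mul_smul, Matrix.mul_one, ← Matrix.map_mul]

/-- **`P² = det B · χ_D`**: the square of the Pfaffian characteristic polynomial is `det B` times
the characteristic polynomial of `D`, for alternating `B` and `B D` over any commutative ring —
Cayley's `det = Pf²` for the alternating polynomial matrix `B D − X B = B (D − X)`, together with
`det(D − X) = χ_D(X)` in even size (in odd size both sides vanish).  This is
"`Det_K(D_𝒥 − s) = [Pf_K C(D_𝒥 − s)]²`" (with `det C = 1`).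
[cite: LuciniEtAl2016, App. D (Det_K(D_𝒥 − s) = [Pf_K C(D_𝒥 − s)]²)] -/
theorem pfaffianCharpoly_sq (hB : Bᵀ = -B) (hBd : ∀ i, B i i = 0) (hM : (B * D)ᵀ = -(B * D))
    (hMd : ∀ i, (B * D) i i = 0) :
    pfaffianCharpoly B D ^ 2 = Polynomial.C B.det * D.charpoly := by
  rw [pfaffianCharpoly, ← det_eq_pfaffian_sq _ (transpose_polyMatrix B D hB hM)
    (polyMatrix_apply_self B D hBd hMd)]
  rcases Nat.even_or_odd n with hn | hn
  · rw [polyMatrix_eq_mul_neg_charmatrix, det_mul, det_neg, Fintype.card_fin, hn.neg_one_pow, one_mul,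
      ← RingHom.mapMatrix_apply, ← RingHom.map_det, Matrix.charpoly]
  · rw [det_eq_zero_of_transpose_eq_neg_of_odd hn _ (transpose_polyMatrix B D hB hM)
        (polyMatrix_apply_self B D hBd hMd),
      det_eq_zero_of_transpose_eq_neg_of_odd hn B hB hBd, map_zero, zero_mul]

/-! ## Degree and top coefficient: the `s → ∞` normalisation -/

/-- For all square `M`, `B` of size `n`: `Pf(M − X B)` has no coefficient above degree `n/2`, and
its `X^{n/2}`-coefficient is `(-1)^{n/2} Pf B` (induction along the Laplace expansion
`pfaffian_fin_add_two`: the top coefficient only sees the `−X B` part of each first-row entry).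
[folklore] -/
private theorem coeff_pfaffian_sub_X_smul :
    ∀ {n : ℕ} (M B : Matrix (Fin n) (Fin n) R),
      (∀ k, n / 2 < k →
          (pfaffian (M.map (Polynomial.C : R →+* R[X]) -
            (X : R[X]) • B.map (Polynomial.C : R →+* R[X]))).coeff k = 0) ∧
        (pfaffian (M.map (Polynomial.C : R →+* R[X]) -
            (X : R[X]) • B.map (Polynomial.C : R →+* R[X]))).coeff (n / 2) =
          (-1) ^ (n / 2) * pfaffian B
  | 0, M, B => by
      refine ⟨fun k hk => ?_, by simp⟩
      have hk' : k ≠ 0 := by omega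
      simp [Polynomial.coeff_one, hk']
  | 1, M, B => by
      refine ⟨fun k hk => ?_, by simp⟩
      simp
  | n + 2, M, B => by
      set N : Matrix (Fin (n + 2)) (Fin (n + 2)) R[X] :=
        M.map (Polynomial.C : R →+* R[X]) - (X : R[X]) • B.map (Polynomial.C : R →+* R[X]) with hN
      have hmin : ∀ j : Fin (n + 1), pfMinor N j =
          (pfMinor M j).map (Polynomial.C : R →+* R[X]) -
            (X : R[X]) • (pfMinor B j).map (Polynomial.C : R →+* R[X]) := fun j => by
        ext a b; rfl
      have ih := fun j : Fin (n + 1) => coeff_pfaffian_sub_X_smul (pfMinor M j) (pfMinor B j)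
      -- coefficient `k + 1` of the `j`-th term of the Laplace expansion
      have key : ∀ (j : Fin (n + 1)) (k : ℕ),
          ((-1 : R[X]) ^ (j : ℕ) * N 0 j.succ * pfaffian (pfMinor N j)).coeff (k + 1) =
            (-1) ^ (j : ℕ) * (M 0 j.succ * (pfaffian (pfMinor N j)).coeff (k + 1) -
              B 0 j.succ * (pfaffian (pfMinor N j)).coeff k) := fun j k => by
        have hentry : N 0 j.succ = Polynomial.C (M 0 j.succ) - X * Polynomial.C (B 0 j.succ) := by
          simp [hN, Matrix.sub_apply, Matrix.smul_apply, Matrix.map_apply]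
        have hrw : (-1 : R[X]) ^ (j : ℕ) * N 0 j.succ * pfaffian (pfMinor N j) =
            Polynomial.C ((-1 : R) ^ (j : ℕ)) * (Polynomial.C (M 0 j.succ) * pfaffian (pfMinor N j) -
              X * (Polynomial.C (B 0 j.succ) * pfaffian (pfMinor N j))) := by
          rw [hentry, map_pow, map_neg, map_one]; ring
        rw [hrw, coeff_C_mul, coeff_sub, coeff_C_mul, coeff_X_mul, coeff_C_mul]
      have hhalf : (n + 2) / 2 = n / 2 + 1 := by omega
      refine ⟨fun k hk => ?_, ?_⟩
      · obtain ⟨k, rfl⟩ : ∃ k', k = k' + 1 := ⟨k - 1, by omega⟩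
        rw [pfaffian_fin_add_two, finsetSum_coeff]
        refine Finset.sum_eq_zero fun j _ => ?_
        rw [key, hmin, (ih j).1 (k + 1) (by omega), (ih j).1 k (by omega)]
        ring
      · rw [hhalf, pfaffian_fin_add_two, finsetSum_coeff, pfaffian_fin_add_two B, Finset.mul_sum]
        refine Finset.sum_congr rfl fun j _ => ?_
        rw [key, hmin, (ih j).1 (n / 2 + 1) (by omega), (ih j).2]
        ring

/-- The Pfaffian characteristic polynomial has no coefficient above degree `n/2`.
[cite: LuciniEtAl2016, App. D (normalization from the s → ∞ limit)] -/
theorem coeff_pfaffianCharpoly_eq_zero {k : ℕ} (hk : n / 2 < k) : (pfaffianCharpoly B D).coeff k = 0 := by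
  unfold pfaffianCharpoly
  exact (coeff_pfaffian_sub_X_smul (B * D) B).1 k hk

/-- `deg P ≤ n/2`. [cite: LuciniEtAl2016, App. D (normalization from the s → ∞ limit)] -/
theorem natDegree_pfaffianCharpoly_le : (pfaffianCharpoly B D).natDegree ≤ n / 2 :=
  natDegree_le_iff_coeff_eq_zero.mpr fun _ hk => coeff_pfaffianCharpoly_eq_zero B D hk

/-- **The `s → ∞` normalisation**: the `X^{n/2}`-coefficient of `P(X) = Pf(B D − X B)` is
`(-1)^{n/2} Pf(B)` — as `s → ∞`, `Pf(B(D − s)) ∼ Pf(−s B) = (−s)^{n/2} Pf(B)` ("The overall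
normalization is determined by the value of the Pfaffian in the `s → ∞` limit").
[cite: LuciniEtAl2016, App. D (normalization from the s → ∞ limit)] -/
theorem coeff_pfaffianCharpoly_half : (pfaffianCharpoly B D).coeff (n / 2) = (-1) ^ (n / 2) * pfaffian B := by
  unfold pfaffianCharpoly
  exact (coeff_pfaffian_sub_X_smul (B * D) B).2

/-! ## Over a field: even algebraic multiplicities -/

section Field

variable {K : Type*} [Field K] {n : ℕ} (B D : Matrix (Fin n) (Fin n) K)

/-- For `det B ≠ 0` the Pfaffian characteristic polynomial is non-zero (its square is
`det B · χ_D`, and `χ_D` is monic). [cite: LuciniEtAl2016, App. D (Det_K(D_𝒥 − s) = [Pf_K C(D_𝒥 − s)]²)] -/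
theorem pfaffianCharpoly_ne_zero (hB : Bᵀ = -B) (hBd : ∀ i, B i i = 0) (hM : (B * D)ᵀ = -(B * D))
    (hMd : ∀ i, (B * D) i i = 0) (hdet : B.det ≠ 0) : pfaffianCharpoly B D ≠ 0 := by
  intro h
  have hsq := pfaffianCharpoly_sq B D hB hBd hM hMd
  rw [h, zero_pow two_ne_zero] at hsq
  exact mul_ne_zero (Polynomial.C_ne_zero.mpr hdet) (Matrix.charpoly_monic D).ne_zero hsq.symm

/-- **Even algebraic multiplicities.**  For alternating `B`, `B D` with `det B ≠ 0` over a field,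
the algebraic multiplicity of every eigenvalue `μ` of `D` is TWICE its multiplicity `m_μ` as a root
of `P(X) = Pf(B D − X B)`: "`Det_K(D_𝒥 − s) = [Pf_K C(D_𝒥 − s)]² = ∏_α (s − λ_α)^{2m_α}` … Notice
that the algebraic multiplicity of `λ_α` is `2m_α`".
[cite: LuciniEtAl2016, App. D (algebraic multiplicity 2m_α)] -/
theorem rootMultiplicity_charpoly_eq_two_mul (hB : Bᵀ = -B) (hBd : ∀ i, B i i = 0)
    (hM : (B * D)ᵀ = -(B * D)) (hMd : ∀ i, (B * D) i i = 0) (hdet : B.det ≠ 0) (μ : K) :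
    D.charpoly.rootMultiplicity μ = 2 * (pfaffianCharpoly B D).rootMultiplicity μ := by
  have hP := pfaffianCharpoly_ne_zero B D hB hBd hM hMd hdet
  have h := congrArg (Polynomial.rootMultiplicity μ) (pfaffianCharpoly_sq B D hB hBd hM hMd)
  rw [pow_two, rootMultiplicity_mul (mul_ne_zero hP hP),
    rootMultiplicity_mul (mul_ne_zero (Polynomial.C_ne_zero.mpr hdet) (Matrix.charpoly_monic D).ne_zero),
    rootMultiplicity_C, zero_add] at h
  omega

/-- **Every eigenvalue of `D` has even algebraic multiplicity** ("Since all multiplicities are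
even …"; Montvay: "every eigenvalue … is (at least) doubly degenerate").
[cite: LuciniEtAl2016, App. D (algebraic multiplicity 2m_α)] -/
theorem even_rootMultiplicity_charpoly (hB : Bᵀ = -B) (hBd : ∀ i, B i i = 0)
    (hM : (B * D)ᵀ = -(B * D)) (hMd : ∀ i, (B * D) i i = 0) (hdet : B.det ≠ 0) (μ : K) :
    Even (D.charpoly.rootMultiplicity μ) :=
  ⟨(pfaffianCharpoly B D).rootMultiplicity μ, by
    rw [rootMultiplicity_charpoly_eq_two_mul B D hB hBd hM hMd hdet, two_mul]⟩

/-- The multiset of eigenvalues of `D` (roots of `χ_D` with multiplicity) is the multiset of roots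
of `P` taken TWICE. [cite: LuciniEtAl2016, App. D (algebraic multiplicity 2m_α)] -/
theorem roots_charpoly_eq_add (hB : Bᵀ = -B) (hBd : ∀ i, B i i = 0) (hM : (B * D)ᵀ = -(B * D))
    (hMd : ∀ i, (B * D) i i = 0) (hdet : B.det ≠ 0) :
    D.charpoly.roots = (pfaffianCharpoly B D).roots + (pfaffianCharpoly B D).roots := by
  have hP := pfaffianCharpoly_ne_zero B D hB hBd hM hMd hdet
  rw [← roots_C_mul D.charpoly hdet, ← pfaffianCharpoly_sq B D hB hBd hM hMd, pow_two,
    roots_mul (mul_ne_zero hP hP)]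

/-- `m_α` is half the algebraic multiplicity: `χ_D` counts every root of `P` twice.
[cite: LuciniEtAl2016, App. D (algebraic multiplicity 2m_α)] -/
theorem count_roots_charpoly [DecidableEq K] (hB : Bᵀ = -B) (hBd : ∀ i, B i i = 0) (hM : (B * D)ᵀ = -(B * D))
    (hMd : ∀ i, (B * D) i i = 0) (hdet : B.det ≠ 0) (μ : K) :
    D.charpoly.roots.count μ = 2 * (pfaffianCharpoly B D).roots.count μ := by
  rw [roots_charpoly_eq_add B D hB hBd hM hMd hdet, Multiset.count_add, two_mul]

/-- For `det B ≠ 0`: `deg P = n/2` and `n` is even (`2 deg P = deg(det B · χ_D) = n`).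
[cite: LuciniEtAl2016, App. D (normalization from the s → ∞ limit)] -/
theorem natDegree_pfaffianCharpoly (hB : Bᵀ = -B) (hBd : ∀ i, B i i = 0) (hM : (B * D)ᵀ = -(B * D))
    (hMd : ∀ i, (B * D) i i = 0) (hdet : B.det ≠ 0) :
    (pfaffianCharpoly B D).natDegree = n / 2 ∧ Even n := by
  have h := congrArg Polynomial.natDegree (pfaffianCharpoly_sq B D hB hBd hM hMd)
  rw [natDegree_pow, natDegree_C_mul hdet, Matrix.charpoly_natDegree_eq_dim, Fintype.card_fin] at h
  exact ⟨by omega, ⟨(pfaffianCharpoly B D).natDegree, by omega⟩⟩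

/-- For `det B ≠ 0` the leading coefficient of `P` is `(-1)^{n/2} Pf(B)` (so `P` is monic up to
the reference sign `(-1)^{n/2} Pf B`, `(Pf B)² = det B`).
[cite: LuciniEtAl2016, App. D (normalization from the s → ∞ limit)] -/
theorem leadingCoeff_pfaffianCharpoly (hB : Bᵀ = -B) (hBd : ∀ i, B i i = 0)
    (hM : (B * D)ᵀ = -(B * D)) (hMd : ∀ i, (B * D) i i = 0) (hdet : B.det ≠ 0) :
    (pfaffianCharpoly B D).leadingCoeff = (-1) ^ (n / 2) * pfaffian B := by
  rw [leadingCoeff, (natDegree_pfaffianCharpoly B D hB hBd hM hMd hdet).1, coeff_pfaffianCharpoly_half]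

/-- **`Pf(B D) = Pf(B) · ∏_α λ_α^{m_α}`** over an algebraically closed field: the Pfaffian of `B D`
is the reference Pfaffian `Pf(B)` times the product of the roots of `P` with multiplicity — the
eigenvalues of `D`, each taken with HALF its (even) algebraic multiplicity.  This is Lucini et
al.'s "`Pf_K C(D_𝒥 − s) = ∏_α (s − λ_α)^{m_α}`" evaluated at `s = 0`, with the `s → ∞`
normalisation `Pf(C)` kept explicit (the printed formula sets it to `1`).
[cite: LuciniEtAl2016, App. D (Pf_K C D_𝒥 = ∏ λ_α^{m_α} …, s = 0)] -/
theorem pfaffian_mul_eq_mul_prod_roots [IsAlgClosed K] (hB : Bᵀ = -B) (hBd : ∀ i, B i i = 0)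
    (hM : (B * D)ᵀ = -(B * D)) (hMd : ∀ i, (B * D) i i = 0) (hdet : B.det ≠ 0) :
    pfaffian (B * D) = pfaffian B * (pfaffianCharpoly B D).roots.prod := by
  set P := pfaffianCharpoly B D with hPdef
  have hsplit : P.Splits := IsAlgClosed.splits P
  have hdeg := natDegree_pfaffianCharpoly B D hB hBd hM hMd hdet
  have hcard : Multiset.card P.roots = n / 2 :=
    (Polynomial.splits_iff_card_roots.mp hsplit).trans hdeg.1
  have h0 : P.eval 0 = pfaffian (B * D) := eval_zero_pfaffianCharpoly B D
  have hneg : P.roots.map (Polynomial.eval 0 ∘ fun a => X - Polynomial.C a) =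
      P.roots.map Neg.neg := Multiset.map_congr rfl fun a _ => by simp
  have heval : P.eval 0 = P.leadingCoeff * (P.roots.map Neg.neg).prod := by
    conv_lhs => rw [hsplit.eq_prod_roots]
    rw [eval_mul, eval_C, eval_multiset_prod, Multiset.map_map, hneg]
  rw [← h0, heval, hPdef, leadingCoeff_pfaffianCharpoly B D hB hBd hM hMd hdet, ← hPdef,
    Multiset.prod_map_neg, hcard]
  have hsq : ((-1 : K) ^ (n / 2)) * (-1) ^ (n / 2) = 1 := by
    rw [← pow_add, ← two_mul, pow_mul]; simp
  linear_combination (pfaffian B * P.roots.prod) * hsq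

end Field

end Literature.LinearAlgebra.Matrix

end
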